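import Mathlib.Computability.Language
import Literature.Computability.Complexity.TimeBounds
import Literature.Computability.Complexity.BoolEncodings
import Literature.Computability.Complexity.Classes
import Literature.Computability.Complexity.Nondeterministic
import HarnessLib

-- provenance: harness21/H21/H21/Prelude/CplxCore/Reductions.lean @ c81f080 (interim HEAD d8f2665); M5 mechanical rewrite
/-!
# Complexity core: polynomial-time many-one reductions and completeness

Trunk `CplxCore`, concept C5 (`Reductions`): polynomial-time many-one (Karp) reducibility,
hardness and completeness for classes of languages over `{0,1}`.

* `PolyTimeReducible ea eb S T` — encoder-explicit polynomial-time many-one reducibility of a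
  set `S ⊆ α` to a set `T ⊆ β` (some `PolyTimeComputable ea eb f` with `a ∈ S ↔ f a ∈ T`);
* `PolyTimeKarpReducible L₁ L₂` — the case `α = β = List Bool`, encoders `id`; notation
  `L₁ ≤ₚ L₂`, declared `scoped` in `namespace Literature.CplxCore.Notation`
  (`open scoped Literature.CplxCore.Notation`);
* `IsHard C L`, `IsComplete C L`, `IsNPHard`, `IsNPComplete`.

Mathlib has the *computable* (untimed) analogue `ManyOneReducible` (`≤₀`) with
`ManyOneReducible.mk`, `manyOneReducible_refl`, `ManyOneReducible.trans` in
`Mathlib/Computability/Reduce.lean`; there is no time-bounded reducibility, hardness or completeness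
notion in Mathlib (searched: `PolyTime`, `Reducible`, `NPHard`, `NPComplete`). We follow the
shape of `ManyOneReducible` but with an explicit time bound and explicit encoders, on top of
`Literature.Computability.Complexity.PolyTimeComputable`.

## Design notes

* Universes `α β Γ₀ Γ₁ : Type` (Mathlib's TM2 API is `Type`-monomorphic; outline D7).
* The notation `≤ₚ` lives in `Literature.CplxCore.Notation` (scoped), *not* in `Literature.CplxCore`, so that
  `open Literature.CplxCore` inside `namespace Literature.PNP` never collides with the scoped `≤ₚ` of
  `H21/Statements/PNP/Wave0.lean` (outline D7/D8).
* `PolyTimeKarpReducible.trans` and closure of `P`/`NP` under `≤ₚ` need composition of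
  polynomial-time machines (`PolyTimeComputable.comp`, Mathlib `proof_wanted`), hence are
  `sorry`d known theorems; accordingly no `IsTrans`/`IsPreorder` instance is registered.
* On `Language Bool` (a complete Boolean algebra) complements are written `Lᶜ`.

## References

* R. M. Karp, *Reducibility among combinatorial problems*, in: Complexity of Computer
  Computations (1972), §3 (polynomial reducibility, completeness).
* S. A. Cook, *The complexity of theorem-proving procedures*, STOC 1971; S. Cook, *The P versus NP
  problem*, Clay Mathematics Institute problem description (2000), Prop. 1.
* S. Arora, B. Barak, *Computational Complexity: A Modern Approach*, CUP 2009, Def. 2.7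
  (Karp reductions, NP-hardness, NP-completeness), Thm. 2.8 (transitivity, closure).
* M. Sipser, *Introduction to the Theory of Computation*, 3rd ed., Def. 7.29, 7.34, Thm. 7.31.
-/

namespace Literature.Computability.Complexity

open _root_.Computability Turing

variable {α β Γ₀ Γ₁ : Type}

/-! ### Reducibility -/

/-- `PolyTimeReducible ea eb S T`: the set `S ⊆ α` is polynomial-time many-one reducible to
`T ⊆ β` with respect to the encoders `ea : α → List Γ₀`, `eb : β → List Γ₁`: there is a
function `f : α → β`, polynomial-time computable (`PolyTimeComputable ea eb f`), such that
`a ∈ S ↔ f a ∈ T` for all `a`. Time-bounded, encoder-explicit analogue of Mathlib's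
`ManyOneReducible`. [Karp 1972, §3; Arora–Barak 2009, Def. 2.7] [cite: Karp1972, §3] -/
def Reductions.PolyTimeReducible (ea : α → List Γ₀) (eb : β → List Γ₁) (S : Set α) (T : Set β) : Prop :=
  ∃ f : α → β, PolyTimeComputable ea eb f ∧ ∀ a, a ∈ S ↔ f a ∈ T

/-- Constructor for `PolyTimeReducible` from an explicit polynomial-time computable reduction
(cf. Mathlib `ManyOneReducible.mk`). [Arora–Barak 2009, Def. 2.7] [cite: AroraBarak2009, Def. 2.7] -/
theorem Reductions.PolyTimeReducible.mk {ea : α → List Γ₀} {eb : β → List Γ₁} {S : Set α} {T : Set β}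
    (f : α → β) (hf : PolyTimeComputable ea eb f) (h : ∀ a, a ∈ S ↔ f a ∈ T) :
    Reductions.PolyTimeReducible ea eb S T :=
  ⟨f, hf, h⟩

/-- `PolyTimeReducible` is reflexive over a finite alphabet (the identity is polynomial-time
computable, Mathlib `Turing.idComputableInPolyTime`). [Arora–Barak 2009, Thm. 2.8] [cite: AroraBarak2009, Thm. 2.8] -/
protected theorem Reductions.PolyTimeReducible.refl [Fintype Γ₀] (ea : α → List Γ₀) (S : Set α) :
    Reductions.PolyTimeReducible ea ea S S :=
  ⟨id, PolyTimeComputable.id ea, fun _ => Iff.rfl⟩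

/-- `PolyTimeKarpReducible L₁ L₂` (notation `L₁ ≤ₚ L₂`, `open scoped Literature.CplxCore.Notation`):
polynomial-time many-one (Karp) reducibility of languages over `{0,1}`, i.e.
`PolyTimeReducible id id L₁ L₂` — some `f : {0,1}* → {0,1}*` in `FP` with
`x ∈ L₁ ↔ f x ∈ L₂`. [Karp 1972, §3; Cook, Clay problem description, §2; Arora–Barak 2009,
Def. 2.7; Sipser, Def. 7.29] [cite: Karp1972, §3] -/
def PolyTimeKarpReducible (L₁ L₂ : Language Bool) : Prop :=
  Reductions.PolyTimeReducible (id : List Bool → List Bool) id L₁ L₂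

/-- `L₁ ≤ₚ L₂`: Karp reducibility `PolyTimeKarpReducible L₁ L₂`, scoped in the notation
namespace `Literature.CplxCore.Notation` (use `open scoped Literature.CplxCore.Notation`; outline D7).
[Karp 1972, §3] -/
scoped[Literature.Computability.Complexity.Notation] infix:50 " ≤ₚ " => Literature.Computability.Complexity.PolyTimeKarpReducible

open scoped Notation

/-- Unfolding lemma: `L₁ ≤ₚ L₂` iff some `f ∈ FP` satisfies `x ∈ L₁ ↔ f x ∈ L₂`.
[Arora–Barak 2009, Def. 2.7] [cite: AroraBarak2009, Def. 2.7] -/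
theorem polyTimeKarpReducible_iff {L₁ L₂ : Language Bool} :
    L₁ ≤ₚ L₂ ↔ ∃ f : List Bool → List Bool, f ∈ FP ∧ ∀ x, x ∈ L₁ ↔ f x ∈ L₂ :=
  Iff.rfl

/-- Karp reducibility is reflexive (via the identity machine). [Arora–Barak 2009, Thm. 2.8(1)] [cite: AroraBarak2009, Thm. 2.8(1] -/
protected theorem PolyTimeKarpReducible.refl (L : Language Bool) : L ≤ₚ L :=
  Reductions.PolyTimeReducible.refl id L

/-- Karp reducibility is transitive: `L₁ ≤ₚ L₂ → L₂ ≤ₚ L₃ → L₁ ≤ₚ L₃`. Needs composition of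
polynomial-time machines (`PolyTimeComputable.comp`, a Mathlib `proof_wanted`).
[Arora–Barak 2009, Thm. 2.8(1); Cook, Clay problem description, Prop. 1(b)] [cite: AroraBarak2009, Thm. 2.8(1] -/
def PolyTimeKarpReducible.trans : Prop :=
  ∀ {L₁ L₂ L₃ : Language Bool} (h₁₂ : L₁ ≤ₚ L₂) (h₂₃ : L₂ ≤ₚ L₃),
    L₁ ≤ₚ L₃

/-- `P` is closed downwards under Karp reductions: `L₁ ≤ₚ L₂ → L₂ ∈ P → L₁ ∈ P`.
[Arora–Barak 2009, Thm. 2.8(2); Cook, Clay problem description, Prop. 1(a); Sipser, Thm. 7.31] [cite: AroraBarak2009, Thm. 2.8(2] -/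
def mem_P_of_karpReducible : Prop :=
  ∀ {L₁ L₂ : Language Bool} (h : L₁ ≤ₚ L₂) (h₂ : L₂ ∈ Classes.P),
    L₁ ∈ Classes.P

/-- `NP` is closed downwards under Karp reductions: `L₁ ≤ₚ L₂ → L₂ ∈ NP → L₁ ∈ NP`.
[Arora–Barak 2009, Thm. 2.8 and Ex. 2.9; Sipser, Ch. 7] [cite: AroraBarak2009, Thm. 2.8 and Ex. 2.9] -/
def mem_NP_of_karpReducible : Prop :=
  ∀ {L₁ L₂ : Language Bool} (h : L₁ ≤ₚ L₂) (h₂ : L₂ ∈ Nondeterministic.NP),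
    L₁ ∈ Nondeterministic.NP

/-- Karp reducibility is preserved by complementing both sides: `L₁ᶜ ≤ₚ L₂ᶜ ↔ L₁ ≤ₚ L₂`
(the same reduction works). [Arora–Barak 2009, §2.6.1] [cite: AroraBarak2009, §2.6.1] -/
theorem karpReducible_compl_iff {L₁ L₂ : Language Bool} : L₁ᶜ ≤ₚ L₂ᶜ ↔ L₁ ≤ₚ L₂ := by
  have hc : ∀ (L : Language Bool) (x : List Bool), x ∈ Lᶜ ↔ x ∉ L := fun _ _ => Iff.rfl
  constructor
  · rintro ⟨f, hf, h⟩
    exact ⟨f, hf, fun x => not_not.symm.trans ((not_congr ((hc _ _).symm.trans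
      ((h x).trans (hc _ _)))).trans not_not)⟩
  · rintro ⟨f, hf, h⟩
    exact ⟨f, hf, fun x => (hc _ _).trans ((not_congr (h x)).trans (hc _ _).symm)⟩

/-! ### Hardness and completeness -/

/-- `IsHard C L`: the language `L` is `C`-hard under Karp reductions, i.e. every `L' ∈ C`
satisfies `L' ≤ₚ L`. [Arora–Barak 2009, Def. 2.7; Sipser, Def. 7.34] [cite: AroraBarak2009, Def. 2.7] -/
def IsHard (C : Set (Language Bool)) (L : Language Bool) : Prop :=
  ∀ L' ∈ C, L' ≤ₚ L

/-- `IsComplete C L`: `L` is `C`-complete under Karp reductions, i.e. `L ∈ C` and `L` is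
`C`-hard. [Arora–Barak 2009, Def. 2.7; Sipser, Def. 7.34] [cite: AroraBarak2009, Def. 2.7] -/
def IsComplete (C : Set (Language Bool)) (L : Language Bool) : Prop :=
  L ∈ C ∧ IsHard C L

/-- `IsNPHard L`: `L` is NP-hard (every language in `NP` Karp-reduces to `L`).
[Karp 1972, §3; Arora–Barak 2009, Def. 2.7] [cite: Karp1972, §3] -/
abbrev IsNPHard (L : Language Bool) : Prop :=
  IsHard Nondeterministic.NP L

/-- `IsNPComplete L`: `L` is NP-complete (`L ∈ NP` and `L` is NP-hard).
[Cook 1971; Karp 1972, §3; Arora–Barak 2009, Def. 2.7; Sipser, Def. 7.34] [cite: Cook1971] -/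
abbrev IsNPComplete (L : Language Bool) : Prop :=
  IsComplete Nondeterministic.NP L

/-- A complete language is hard. [Arora–Barak 2009, Def. 2.7] [cite: AroraBarak2009, Def. 2.7] -/
theorem IsComplete.isHard {C : Set (Language Bool)} {L : Language Bool} (h : IsComplete C L) :
    IsHard C L :=
  h.2

/-- A complete language belongs to its class. [Arora–Barak 2009, Def. 2.7] [cite: AroraBarak2009, Def. 2.7] -/
theorem IsComplete.mem {C : Set (Language Bool)} {L : Language Bool} (h : IsComplete C L) :
    L ∈ C :=
  h.1

/-- Hardness propagates along reductions: if `L` is `C`-hard and `L ≤ₚ L'` then `L'` is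
`C`-hard (by transitivity of `≤ₚ`). This is the standard way of proving NP-hardness.
[Arora–Barak 2009, Thm. 2.8; Karp 1972, §4] [cite: AroraBarak2009, Thm. 2.8] -/
def IsHard.of_reducible : Prop :=
  ∀ {C : Set (Language Bool)} {L L' : Language Bool} (h : IsHard C L) (hLL' : L ≤ₚ L'),
    IsHard C L'

/- interim proof relied on results that are now named facts (D-0014); demoted to a fact by the M5 import, proof preserved:
:=
  fun L'' hL'' => (h L'' hL'').trans hLL'
-/

/-- Completeness propagates along reductions inside the class: if `L` is `C`-complete,
`L ≤ₚ L'` and `L' ∈ C`, then `L'` is `C`-complete. [Arora–Barak 2009, Thm. 2.8; Karp 1972, §4] [cite: AroraBarak2009, Thm. 2.8] -/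
def IsComplete.of_reducible : Prop :=
  ∀ {C : Set (Language Bool)} {L L' : Language Bool} (h : IsComplete C L) (hLL' : L ≤ₚ L') (hL' : L' ∈ C),
    IsComplete C L'

/- interim proof relied on results that are now named facts (D-0014); demoted to a fact by the M5 import, proof preserved:
:=
  ⟨hL', h.isHard.of_reducible hLL'⟩
-/

/-- If some NP-hard language is in `P` then `NP ⊆ P` (hence `P = NP` with `P_subset_NP`).
[Arora–Barak 2009, Thm. 2.8(3); Sipser, Thm. 7.35] [cite: AroraBarak2009, Thm. 2.8(3] -/
def NP_subset_P_of_isNPHard_of_mem_P : Prop :=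
  ∀ {L : Language Bool} (h : IsNPHard L) (hL : L ∈ Classes.P),
    Nondeterministic.NP ⊆ Classes.P

/- interim proof relied on results that are now named facts (D-0014); demoted to a fact by the M5 import, proof preserved:
:=
  fun L' hL' => mem_P_of_karpReducible (h L' hL') hL
-/

/-- If an NP-complete language is in `P` then `P = NP`. [Arora–Barak 2009, Thm. 2.8(3);
Sipser, Thm. 7.35] [cite: AroraBarak2009, Thm. 2.8(3] -/
def P_eq_NP_of_isNPComplete_of_mem_P : Prop :=
  ∀ {L : Language Bool} (h : IsNPComplete L) (hL : L ∈ Classes.P),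
    Classes.P = Nondeterministic.NP

/- interim proof relied on results that are now named facts (D-0014); demoted to a fact by the M5 import, proof preserved:
:=
  Set.Subset.antisymm P_subset_NP (NP_subset_P_of_isNPHard_of_mem_P h.isHard hL)
-/

end Literature.Computability.Complexity
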